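import Mathlib
import HarnessLib
import Summits.NavierStokesRegularity.NavierStokesRegularity.Theorems.PoloidalWindowDoorPoloidalWindowRigiditySeparatedShearDecay
import Summits.NavierStokesRegularity.NavierStokesRegularity.Theorems.PoloidalWindowDoorPoloidalWindowRigidityConstantShearTest

/-!
# Route `PoloidalWindowDoor`, crux `PoloidalWindowRigidity` (K2, stmt-NavierStokesRegularity-19708) —
# the SEPARATED-PRESSURE stratum: testing the averaged vertical momentum equation in the height

Cell ns-regularity-ideate, seat ns-poloidal-K2-p2 (stub-worker, gen 2; support lemmas `--supports` the crux,
`--as helper`).  Verbatim `…ConstantShearTest` with the constant-shear hypothesis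
replaced by the separated-pressure hypothesis `hsep` (`∇_h f₂ ≡ 0`, so `f₂` depends on `(t, x₂)` only,
`…SeparatedShearVariance.residual_vert_eq_of_height_eq_of_sep`); `vres v t z = f₂(t, z e₂)` as in `…ConstantShearTest`.  By (b) of `…ConstantShearMeans`,
`vres = ⟨∂ₜv₂⟩ + ∂_z⟨v₂²⟩ − ⟨∂₂²v₂⟩ + O(1/R)` at every height; testing against a `C¹` function `ρ` supported in
`[a,b]` with `∫ρ = 0` and integrating by parts (`⟨v₂²⟩ = V + ⟨v₂⟩²`, `∂_z⟨v₂⟩ = O(1/R)`, `∂_z⟨∂ₜv₂⟩ = O(1/R)` since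
`∂ₜv` is divergence-free):

* `abs_integral_vres_mul_le_sep` — `|∫ vres ρ| ≤ sup|ρ'| · ∫_{[a,b]} V_R + ‖ρ‖₁ · K(t, b−a)/R`.

With `…SeparatedShearDecay.variance_small_sep` this forces `∫ vres ρ = 0` (sequel `…SeparatedShear`).

WHAT THIS IS NOT: not a claim about Navier–Stokes regularity and not the open residue S2⁗ — one located stratum of a
door route's Type-I Liouville problem (bears_on LADDER-NS N0, rung N0-LocalTubeDoorPoloidal).
-/

noncomputable section

-- the summit and its single sub-problem share the name (CONVENTIONS §1), as in every Theorems file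
set_option linter.dupNamespace false

namespace Summit.NavierStokesRegularity.NavierStokesRegularity.Theorems.PoloidalWindowDoorPoloidalWindowRigiditySeparatedShearTest

open MeasureTheory Set Function Filter Topology Metric InnerProductSpace
open scoped RealInnerProductSpace InnerProductSpace Laplacian ContDiff
open Literature.Analysis Literature.Analysis.FluidPDE
open Summit.NavierStokesRegularity.NavierStokesRegularity.Theorems.PoloidalWindowDoorPoloidalWindowRigidityWindow
open Summit.NavierStokesRegularity.NavierStokesRegularity.Theorems.PoloidalWindowDoorPoloidalWindowRigidityHorizontalMean
open Summit.NavierStokesRegularity.NavierStokesRegularity.Theorems.PoloidalWindowDoorPoloidalWindowRigidityConstantShearMeans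
open Summit.NavierStokesRegularity.NavierStokesRegularity.Theorems.PoloidalWindowDoorPoloidalWindowRigidityConstantShearSlice
open Summit.NavierStokesRegularity.NavierStokesRegularity.Theorems.PoloidalWindowDoorPoloidalWindowRigidityConstantShearVariance
open Summit.NavierStokesRegularity.NavierStokesRegularity.Theorems.PoloidalWindowDoorPoloidalWindowRigidityConstantShearTest
open Summit.NavierStokesRegularity.NavierStokesRegularity.Theorems.PoloidalWindowDoorPoloidalWindowRigiditySeparatedShearVariance

variable {φ : ContDiffBump (0 : EuclideanSpace ℝ (Fin 2))} {R : ℝ}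
  {v : ℝ → EuclideanSpace ℝ (Fin 3) → EuclideanSpace ℝ (Fin 3)} {C : ℝ}

section Class

variable (hrate : HasTypeITimeDecay C v) (hcont : ContinuousOn (uncurry v) (Iio (0 : ℝ) ×ˢ univ))
  (hmild : ∀ s t : ℝ, s < t → t < 0 → ∀ x,
    v t x = UnboundedOperators.heatExtension (v s) (t - s) x - oseenDuhamel 1 s v v t x)
  (hdiv : ∀ t < 0, VectorCalculus.IsDivFree (v t))

include hrate hcont hmild hdiv

/-- **THE TESTED VERTICAL MOMENTUM EQUATION.**  On the separated-pressure stratum (`∇_h f₂ ≡ 0`), for `t < 0`, `R > 0`, a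
window `a ≤ b` and a `C¹` test function `ρ` with `ρ = ρ' = 0` off `[a,b]`, `∫ρ = 0`, `|ρ'| ≤ B₁`:
`|∫ vres(t,z) ρ(z) dz| ≤ B₁ ∫_{[a,b]} V_R(t,z) dz + (‖ρ‖₁/R)·((M₀²+M₁) + M₁ + 2M₀² + M₄(b−a))·K`,
`M₀ = C/√(−t)`, `M₁ = C₁/(−t)`, `M₄ = C₄/((−t)√(−t))`, `K = ‖∂₀φ̄‖₁ + ‖∂₁φ̄‖₁`. -/
theorem abs_integral_vres_mul_le_sep (hsep : ∀ t < 0, ∀ x, ∀ b : Fin 3, b ≠ 2 →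
      fderiv ℝ (fun y => timeDerivWithin (Iio 0) v t y + convect (v t) (v t) y - Δ (v t) y) x
        (EuclideanSpace.single b 1) 2 = 0)
    {C₁ : ℝ} (hC₁ : ∀ t < 0, ∀ y, ‖fderiv ℝ (v t) y‖ ≤ C₁ / (-t))
    {C₄ : ℝ} (hC₄ : ∀ t < 0, ∀ y, ‖deriv (fun τ => v τ y) t‖ ≤ C₄ / ((-t) * Real.sqrt (-t)))
    (hR : 0 < R) {t : ℝ} (ht : t < 0) {a b : ℝ} (hab : a ≤ b)
    {ρ : ℝ → ℝ} (hρ : ContDiff ℝ 1 ρ) (hρ0 : ∀ z ∉ Icc a b, ρ z = 0) (hρ1 : ∀ z ∉ Icc a b, deriv ρ z = 0)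
    (hρi : ∫ z, ρ z = 0) {B₁ : ℝ} (hB₁ : ∀ z, |deriv ρ z| ≤ B₁) :
    |∫ z, vres v t z * ρ z| ≤
      B₁ * (∫ z in Icc a b, sliceV φ R v t z) +
        (∫ z, |ρ z|) * (R⁻¹ * ((C / Real.sqrt (-t) * (C / Real.sqrt (-t)) + C₁ / (-t)) + C₁ / (-t) +
          2 * (C / Real.sqrt (-t) * (C / Real.sqrt (-t))) + C₄ / ((-t) * Real.sqrt (-t)) * (b - a)) * bumpK φ) := by
  have hA : IsTypeIAncientMild C v := isTypeIAncientMild_of_class hrate hcont hmild hdiv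
  have hu : ContDiff ℝ 2 (v t) := (hA.contDiff_slice ht).of_le (by norm_cast)
  have hud : Differentiable ℝ (v t) := hu.differentiable (by norm_num)
  have hdiv' := fun x => div_coord (hdiv t ht) x
  have hθ : ContDiff ℝ ∞ (fun y => v t y 2) := contDiff_vert hrate hcont hmild hdiv ht
  have hθt : ContDiff ℝ ∞ (fun y => deriv (fun s => v s y) t 2) := contDiff_vertT hrate hcont hmild hdiv ht
  set M₀ := C / Real.sqrt (-t) with hM₀
  set M₁ := C₁ / (-t) with hM₁
  set M₄ := C₄ / ((-t) * Real.sqrt (-t)) with hM₄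
  have hM₀b : ∀ x, ‖v t x‖ ≤ M₀ := fun x => hrate t ht x
  have hM₀0 : 0 ≤ M₀ := (norm_nonneg _).trans (hM₀b 0)
  have hK0 : 0 ≤ bumpK φ := bumpK_nonneg φ
  -- compact support of `ρ` and of `ρ'`; integrability helpers
  have hρc : Continuous ρ := hρ.continuous
  have hρ'c : Continuous (deriv ρ) := hρ.continuous_deriv le_rfl
  have hK : IsCompact (Icc a b) := isCompact_Icc
  have hρsupp : HasCompactSupport ρ :=
    HasCompactSupport.of_support_subset_isCompact hK fun z hz => by
      by_contra h; exact hz (hρ0 z h)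
  have hρ'supp : HasCompactSupport (deriv ρ) :=
    HasCompactSupport.of_support_subset_isCompact hK fun z hz => by
      by_contra h; exact hz (hρ1 z h)
  have integ : ∀ {F : ℝ → ℝ}, Continuous F → Integrable fun z => F z * ρ z := fun hF =>
    (hF.mul hρc).integrable_of_hasCompactSupport hρsupp.mul_left
  have integ' : ∀ {F : ℝ → ℝ}, Continuous F → Integrable fun z => F z * deriv ρ z := fun hF =>
    (hF.mul hρ'c).integrable_of_hasCompactSupport hρ'supp.mul_left
  have iabs : Integrable fun z => |ρ z| := (hρc.integrable_of_hasCompactSupport hρsupp).abs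
  -- the four height functions: `g`, `mt = ⟨∂ₜv₂⟩`, `Ez = ∂_z⟨v₂²⟩`, `mzz = ⟨∂₂²v₂⟩`
  set g : ℝ → ℝ := fun z => vres v t z with hg
  set mt : ℝ → ℝ := fun z => hmean φ 0 R z (fun x => deriv (fun s => v s x) t 2) with hmt
  set E : ℝ → ℝ := fun z => sliceE φ R v t z with hE
  set Ez : ℝ → ℝ := fun z => hmean φ 0 R z (fun x => fderiv ℝ (fun y => v t y 2 ^ 2) x (EuclideanSpace.single 2 (1 : ℝ))) with hEz
  set mzz : ℝ → ℝ := fun z => hmean φ 0 R z (fun x => fderiv ℝ (fun y => fderiv ℝ (fun y' => v t y' 2) y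
    (EuclideanSpace.single 2 (1 : ℝ))) x (EuclideanSpace.single 2 (1 : ℝ))) with hmzz
  set m : ℝ → ℝ := fun z => sliceM φ R v t z with hm
  set mz : ℝ → ℝ := fun z => hmean φ 0 R z (fun x => fderiv ℝ (v t) x (EuclideanSpace.single 2 (1 : ℝ)) 2) with hmz
  -- continuity in the height
  have cg : Continuous g := continuous_vres hrate hcont hmild hdiv ht
  have cmt : Continuous mt := continuous_hmean_height (φ := φ) (R := R) 0 (hθt.of_le (by norm_cast))
  have cEz : Continuous Ez := continuous_hmean_height (φ := φ) (R := R) 0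
    ((((hθ.of_le (m := 2) (by norm_cast)).pow 2).fderiv_right (m := 1) (by norm_cast)).clm_apply contDiff_const)
  have hΨ2 : ContDiff ℝ 2 (fun y => fderiv ℝ (fun y' => v t y' 2) y (EuclideanSpace.single 2 (1 : ℝ))) :=
    ((hθ.of_le (m := 3) (by norm_cast)).fderiv_right (m := 2) (by norm_cast)).clm_apply contDiff_const
  have cmzz : Continuous mzz := continuous_hmean_height (φ := φ) (R := R) 0
    ((hΨ2.fderiv_right (m := 1) (by norm_cast)).clm_apply contDiff_const)
  have cm : Continuous m := continuous_hmean_height (φ := φ) (R := R) 0 (hθ.of_le (by norm_cast))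
  have cmz : Continuous mz := continuous_hmean_height (φ := φ) (R := R) 0 (contDiff_one_fderiv_apply hu _ 2)
  obtain ⟨cV, -, -, -⟩ := continuous_slices (φ := φ) (R := R) hrate hcont hmild hdiv ht
  have cE : Continuous E := by
    have : E = fun z => sliceV φ R v t z + m z ^ 2 := by funext z; simp [hE, hm, sliceV]
    rw [this]; exact cV.add (cm.pow 2)
  -- (0) the pointwise identity (b): `|g − (mt + Ez − mzz)| ≤ (M₀²+M₁)K/R`
  have h0 : ∀ z, |g z - (mt z + Ez z - mzz z)| ≤ R⁻¹ * (M₀ * M₀ + M₁) * bumpK φ := by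
    intro z
    have heq : ∀ x, deriv (fun s => v s x) t 2 + fderiv ℝ (fun y => v t y 2) x (v t x) -
        ∑ i : Fin 3, fderiv ℝ (fun y => fderiv ℝ (fun y' => v t y' 2) y (EuclideanSpace.single i (1 : ℝ))) x
          (EuclideanSpace.single i (1 : ℝ)) = g (x 2) := by
      intro x
      rw [← (hasDerivAt_vert hrate hcont hmild hdiv ht x).deriv, vertical_equation_coord hrate hcont hmild hdiv ht x, hg]
      exact residual_vert_eq_of_height_eq_of_sep hrate hcont hmild hdiv hsep ht (by simp)
    have h := residual_mean φ 0 z hu hdiv' hM₀b (hC₁ t ht) hθt.continuous heq hR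
    simpa [hmt, hEz, hmzz] using h
  -- (1) the remainder term
  have h1 : |∫ z, (g z - (mt z + Ez z - mzz z)) * ρ z| ≤ R⁻¹ * (M₀ * M₀ + M₁) * bumpK φ * ∫ z, |ρ z| := by
    rw [← integral_const_mul]
    refine (abs_integral_le_integral_abs).trans (integral_mono_of_nonneg (Eventually.of_forall fun z => abs_nonneg _)
      (iabs.const_mul _) (Eventually.of_forall fun z => ?_))
    dsimp only
    rw [abs_mul]
    exact mul_le_mul_of_nonneg_right (h0 z) (abs_nonneg _)
  -- (2) `|∫ mzz ρ| ≤ (M₁K/R) ‖ρ‖₁`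
  have h2 : |∫ z, mzz z * ρ z| ≤ R⁻¹ * M₁ * bumpK φ * ∫ z, |ρ z| := by
    rw [← integral_const_mul]
    refine (abs_integral_le_integral_abs).trans (integral_mono_of_nonneg (Eventually.of_forall fun z => abs_nonneg _)
      (iabs.const_mul _) (Eventually.of_forall fun z => ?_))
    dsimp only
    rw [abs_mul]
    refine mul_le_mul_of_nonneg_right ?_ (abs_nonneg _)
    have h := abs_hmean_dzz_le φ 0 z hu hdiv' (hC₁ t ht) hR
    have hfun : (fun y => fderiv ℝ (v t) y (EuclideanSpace.single 2 (1 : ℝ)) 2) =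
        fun y => fderiv ℝ (fun y' => v t y' 2) y (EuclideanSpace.single 2 (1 : ℝ)) :=
      funext fun y => (fderiv_coord_apply (hud y) 2 _).symm
    rw [hfun] at h
    exact h
  -- (3) `∫ Ez ρ = −∫ E ρ'`, `E = V + m²`, `∫ m² ρ' = −∫ 2 m mz ρ`
  have hEd : ∀ z, HasDerivAt E (Ez z) z := fun z =>
    hmean_hasDerivAt_height φ 0 R z ((hθ.of_le (m := 1) (by norm_cast)).pow 2)
  have hmd : ∀ z, HasDerivAt m (mz z) z := fun z => hasDerivAt_sliceM_height hrate hcont hmild hdiv ht z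
  have h3a : ∫ z, Ez z * ρ z = -∫ z, E z * deriv ρ z := by
    have h := integral_mul_fderiv_eq_neg_fderiv_mul_of_integrable (μ := (volume : Measure ℝ)) (f := E) (g := ρ)
      (v := (1 : ℝ)) ?_ ?_ ?_ (fun z _ => (hEd z).differentiableAt) (fun z _ => (hρ.differentiable one_ne_zero) z)
    · simp only [fderiv_apply_one_eq_deriv, fun z => (hEd z).deriv] at h
      linarith
    · simp only [fderiv_apply_one_eq_deriv, fun z => (hEd z).deriv]; exact integ cEz
    · simp only [fderiv_apply_one_eq_deriv]; exact integ' cE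
    · exact integ cE
  have h3b : ∫ z, (m z) ^ 2 * deriv ρ z = -∫ z, (2 * m z * mz z) * ρ z := by
    have hm2 : ∀ z, HasDerivAt (fun ζ => m ζ ^ 2) (2 * m z * mz z) z := fun z => by
      have h := (hmd z).mul (hmd z)
      have e : (m * m) = fun ζ => m ζ ^ 2 := by funext ζ; simp [pow_two]
      rw [e] at h
      refine h.congr_deriv ?_
      ring
    have h := integral_mul_fderiv_eq_neg_fderiv_mul_of_integrable (μ := (volume : Measure ℝ)) (f := fun ζ => m ζ ^ 2)
      (g := ρ) (v := (1 : ℝ)) ?_ ?_ ?_ (fun z _ => (hm2 z).differentiableAt) (fun z _ => (hρ.differentiable one_ne_zero) z)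
    · simp only [fderiv_apply_one_eq_deriv, fun z => (hm2 z).deriv] at h
      exact h
    · simp only [fderiv_apply_one_eq_deriv, fun z => (hm2 z).deriv]; exact integ ((continuous_const.mul cm).mul cmz)
    · simp only [fderiv_apply_one_eq_deriv]; exact integ' (cm.pow 2)
    · exact integ (cm.pow 2)
  have h3c : |∫ z, (2 * m z * mz z) * ρ z| ≤ R⁻¹ * (2 * (M₀ * M₀)) * bumpK φ * ∫ z, |ρ z| := by
    rw [← integral_const_mul]
    refine (abs_integral_le_integral_abs).trans (integral_mono_of_nonneg (Eventually.of_forall fun z => abs_nonneg _)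
      (iabs.const_mul _) (Eventually.of_forall fun z => ?_))
    dsimp only
    rw [abs_mul]
    refine mul_le_mul_of_nonneg_right ?_ (abs_nonneg _)
    have hmb : |m z| ≤ M₀ := abs_hmean_le φ 0 R z hθ.continuous fun x => (abs_apply_le_norm _ 2).trans (hM₀b x)
    have hzb : |mz z| ≤ R⁻¹ * M₀ * bumpK φ := abs_hmean_dz_le φ 0 z hu hdiv' hM₀b hR
    rw [abs_mul, abs_mul, abs_two]
    calc 2 * |m z| * |mz z| ≤ 2 * M₀ * (R⁻¹ * M₀ * bumpK φ) :=
          mul_le_mul (mul_le_mul_of_nonneg_left hmb zero_le_two) hzb (abs_nonneg _) (by positivity)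
      _ = _ := by ring
  have h3d : |∫ z, sliceV φ R v t z * deriv ρ z| ≤ B₁ * ∫ z in Icc a b, sliceV φ R v t z := by
    have hzero : ∀ z ∉ Icc a b, sliceV φ R v t z * deriv ρ z = 0 := fun z hz => by rw [hρ1 z hz, mul_zero]
    rw [← setIntegral_eq_integral_of_forall_compl_eq_zero hzero, ← integral_const_mul]
    refine (abs_integral_le_integral_abs).trans (setIntegral_mono_on ((cV.mul hρ'c).abs.integrableOn_Icc)
      ((cV.integrableOn_Icc).const_mul _) measurableSet_Icc fun z _ => ?_)
    rw [abs_mul, abs_of_nonneg (sliceV_nonneg hrate hcont hmild hdiv ht z), mul_comm]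
    exact mul_le_mul_of_nonneg_right (hB₁ z) (sliceV_nonneg hrate hcont hmild hdiv ht z)
  -- (4) `∫ mt ρ = ∫ (mt − mt a) ρ`, `|mt z − mt a| ≤ (M₄K/R)(b − a)` on `[a,b]`
  have hmtd : ∀ z, HasDerivAt mt (hmean φ 0 R z (fun x => fderiv ℝ (fun y => deriv (fun s => v s y) t 2) x
      (EuclideanSpace.single 2 (1 : ℝ)))) z := fun z =>
    hmean_hasDerivAt_height φ 0 R z (hθt.of_le (by norm_cast))
  have hmtz : ∀ z, |hmean φ 0 R z (fun x => fderiv ℝ (fun y => deriv (fun s => v s y) t 2) x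
      (EuclideanSpace.single 2 (1 : ℝ)))| ≤ R⁻¹ * M₄ * bumpK φ := by
    intro z
    have hw : ContDiff ℝ 2 (fun y => deriv (fun s => v s y) t) :=
      (contDiff_timeDeriv_slice hrate hcont hmild hdiv ht).of_le (by norm_cast)
    have hwd : Differentiable ℝ (fun y => deriv (fun s => v s y) t) := hw.differentiable (by norm_num)
    have h := abs_hmean_dz_le φ 0 z hw (fun x => div_timeDeriv_slice hrate hcont hmild hdiv ht x) (hC₄ t ht) hR
    have hfun : (fun y => fderiv ℝ (fun y' => deriv (fun s => v s y') t) y (EuclideanSpace.single 2 (1 : ℝ)) 2) =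
        fun y => fderiv ℝ (fun y' => deriv (fun s => v s y') t 2) y (EuclideanSpace.single 2 (1 : ℝ)) :=
      funext fun y => (fderiv_coord_apply (hwd y) 2 _).symm
    rw [hfun] at h
    exact h
  have h4 : |∫ z, mt z * ρ z| ≤ R⁻¹ * M₄ * bumpK φ * (b - a) * ∫ z, |ρ z| := by
    have hsplit : ∫ z, mt z * ρ z = ∫ z, (mt z - mt a) * ρ z := by
      have hsub := integral_sub (μ := (volume : Measure ℝ)) (f := fun z => mt z * ρ z) (g := fun z => mt a * ρ z)
        (integ cmt) (integ (F := fun _ => mt a) continuous_const)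
      have hc : ∫ z, mt a * ρ z = 0 := by rw [integral_const_mul, hρi, mul_zero]
      simp only [sub_mul]
      rw [hsub, hc, sub_zero]
    rw [hsplit, ← integral_const_mul]
    refine (abs_integral_le_integral_abs).trans (integral_mono_of_nonneg (Eventually.of_forall fun z => abs_nonneg _)
      (iabs.const_mul _) (Eventually.of_forall fun z => ?_))
    dsimp only
    rw [abs_mul]
    by_cases hz : z ∈ Icc a b
    · refine mul_le_mul_of_nonneg_right ?_ (abs_nonneg _)
      have hmv := Convex.norm_image_sub_le_of_norm_deriv_le (f := mt) (s := Icc a b)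
        (fun x _ => (hmtd x).differentiableAt) (fun x _ => by rw [(hmtd x).deriv]; exact hmtz x) (convex_Icc a b)
        (left_mem_Icc.2 hab) hz
      rw [Real.norm_eq_abs, Real.norm_eq_abs, abs_of_nonneg (by linarith [hz.1] : (0:ℝ) ≤ z - a)] at hmv
      refine hmv.trans (mul_le_mul_of_nonneg_left (by linarith [hz.2]) ?_)
      have : 0 ≤ M₄ := by
        have h := (norm_nonneg _).trans (hC₄ t ht 0); rwa [← hM₄] at h
      positivity
    · rw [hρ0 z hz, abs_zero, mul_zero, mul_zero]
  -- assemble: `∫ gρ = ∫ (g − mt − Ez + mzz)ρ + ∫ mtρ + ∫ Ezρ − ∫ mzzρ`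
  have hsum : ∫ z, g z * ρ z = (∫ z, (g z - (mt z + Ez z - mzz z)) * ρ z) + (∫ z, mt z * ρ z) +
      (∫ z, Ez z * ρ z) - ∫ z, mzz z * ρ z := by
    have e1 : (fun z => g z * ρ z) = fun z => (g z - (mt z + Ez z - mzz z)) * ρ z + mt z * ρ z + Ez z * ρ z - mzz z * ρ z := by
      funext z; ring
    rw [e1, integral_sub, integral_add, integral_add]
    · exact integ (cg.sub ((cmt.add cEz).sub cmzz))
    · exact integ cmt
    · exact (integ (cg.sub ((cmt.add cEz).sub cmzz))).add (integ cmt)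
    · exact integ cEz
    · exact ((integ (cg.sub ((cmt.add cEz).sub cmzz))).add (integ cmt)).add (integ cEz)
    · exact integ cmzz
  have hEsplit : ∫ z, E z * deriv ρ z = (∫ z, sliceV φ R v t z * deriv ρ z) + ∫ z, (m z) ^ 2 * deriv ρ z := by
    have e1 : (fun z => E z * deriv ρ z) = fun z => sliceV φ R v t z * deriv ρ z + (m z) ^ 2 * deriv ρ z := by
      funext z; simp only [hE, hm, sliceV]; ring
    rw [e1, integral_add (integ' cV) (integ' (F := fun z => m z ^ 2) (cm.pow 2))]
  have hpos : 0 ≤ ∫ z, |ρ z| := integral_nonneg fun z => abs_nonneg _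
  have hI : 0 ≤ ∫ z in Icc a b, sliceV φ R v t z :=
    setIntegral_nonneg measurableSet_Icc fun z _ => sliceV_nonneg hrate hcont hmild hdiv ht z
  rw [show (fun z => vres v t z * ρ z) = fun z => g z * ρ z from rfl, hsum, h3a, hEsplit, h3b]
  have hB₁0 : 0 ≤ B₁ := (abs_nonneg _).trans (hB₁ 0)
  calc |(∫ z, (g z - (mt z + Ez z - mzz z)) * ρ z) + (∫ z, mt z * ρ z) +
        -((∫ z, sliceV φ R v t z * deriv ρ z) + -∫ z, 2 * m z * mz z * ρ z) - ∫ z, mzz z * ρ z|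
      ≤ |∫ z, (g z - (mt z + Ez z - mzz z)) * ρ z| + |∫ z, mt z * ρ z| +
        (|∫ z, sliceV φ R v t z * deriv ρ z| + |∫ z, 2 * m z * mz z * ρ z|) + |∫ z, mzz z * ρ z| := by
        have t1 := abs_sub (( ∫ z, (g z - (mt z + Ez z - mzz z)) * ρ z) + (∫ z, mt z * ρ z) +
          -((∫ z, sliceV φ R v t z * deriv ρ z) + -∫ z, 2 * m z * mz z * ρ z)) (∫ z, mzz z * ρ z)
        have t2 := abs_add_le ((∫ z, (g z - (mt z + Ez z - mzz z)) * ρ z) + (∫ z, mt z * ρ z))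
          (-((∫ z, sliceV φ R v t z * deriv ρ z) + -∫ z, 2 * m z * mz z * ρ z))
        have t3 := abs_add_le (∫ z, (g z - (mt z + Ez z - mzz z)) * ρ z) (∫ z, mt z * ρ z)
        have t4 : |-((∫ z, sliceV φ R v t z * deriv ρ z) + -∫ z, 2 * m z * mz z * ρ z)| ≤
            |∫ z, sliceV φ R v t z * deriv ρ z| + |∫ z, 2 * m z * mz z * ρ z| := by
          rw [abs_neg]
          exact (abs_add_le _ _).trans (by rw [abs_neg])
        linarith
    _ ≤ R⁻¹ * (M₀ * M₀ + M₁) * bumpK φ * (∫ z, |ρ z|) + R⁻¹ * M₄ * bumpK φ * (b - a) * (∫ z, |ρ z|) +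
        (B₁ * (∫ z in Icc a b, sliceV φ R v t z) + R⁻¹ * (2 * (M₀ * M₀)) * bumpK φ * ∫ z, |ρ z|) +
        R⁻¹ * M₁ * bumpK φ * ∫ z, |ρ z| := by
        gcongr
    _ = _ := by ring

end Class

end Summit.NavierStokesRegularity.NavierStokesRegularity.Theorems.PoloidalWindowDoorPoloidalWindowRigiditySeparatedShearTest

end
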